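import Mathlib
import Summits.NavierStokesRegularity.NavierStokesRegularity.Theses.TypeIQuarterGate
import Literature.Analysis.FluidPDE.ClassicalSolution
import Literature.Analysis.FluidPDE.LerayHopf
import Literature.Analysis.FluidPDE.SuitableWeak
import Literature.Analysis.FluidPDE.SelfSimilar
import Literature.Analysis.FluidPDE.TypeIAncientMild
import Summits.NavierStokesRegularity.NavierStokesRegularity.Theorems.DssFarFieldSlavingBlowupTypeIDssProfileSimilarityEnstrophyTimeOnlyThreshold
-- LANDED (ns-sz-p1 g2): the line's six definitions (p606736) and STUB A `stub_violatorsApproachScar` (p607379)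
import Summits.NavierStokesRegularity.NavierStokesRegularity.Theorems.TypeIQuarterGateScarZoomDefs
import Summits.NavierStokesRegularity.NavierStokesRegularity.Theorems.TypeIQuarterGateScarEnvelopeTypeIViolatorsApproachScar
-- LANDED (ns-sz-p1 g2): STUB B `stub_scarZoom` (twin zoom via the tree's A–B/B–P engine)
import Summits.NavierStokesRegularity.NavierStokesRegularity.Theorems.TypeIQuarterGateScarEnvelopeTypeIScarZoom
-- LANDED (ns-sz-p1 g2): STUB 0 `stub_blowupIsCompact` (Kato far-field / interior / initial-layer bounds)
import Summits.NavierStokesRegularity.NavierStokesRegularity.Theorems.TypeIQuarterGateScarEnvelopeTypeIBlowupIsCompact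

/-!
# Line `scar-zoom` for crux `TypeIQuarterGate.ScarEnvelopeTypeI` (stmt-NavierStokesRegularity-23843)

ns-idea-7 (lens «nearmiss», target «DSS wall»).  No summit is proved by this line.

Thesis of the line.  Given finitely many scars, the Type-I space–time envelope
`‖u‖ ≤ C' + Σ_a C'/(|x−a|+√(T−t))` can only fail through ENVELOPE VIOLATORS `(x_k,t_k) → (a,T)`
sitting parabolically far from a scar, `|x_k−a|/√(T−t_k) → ∞`, with `|x_k−a|·‖u(x_k,t_k)‖ → ∞`
(`stub_violatorsApproachScar`, size M, elementary from the Type-I rate, the finite-scar clause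
and TAMENESS OUTSIDE THE BLOW-UP REGION — `stub_blowupIsCompact`, size L, the 3-D weak–strong
uniqueness / far-field regularity infrastructure that every proof of this crux needs because its
envelope quantifies over all of `[0,T)`, isolated as its own stub).  Zooming at the
scar with the violator distance `ρ_k = |x_k−a|` produces (`stub_scarZoom`, size L: ν-normalisation,
Leray–Hopf rescaling, Seregin/Albritton–Barker rate-to-scaled-energy bounds, KNSS slab
compactness, Wolf's velocity ε-regularity for singularity persistence at BOTH points) a
TWIN-SCAR OBJECT: an ancient mild solution with the time-Type-I bound, uniformly locally
square-integrable up to the final time, singular at time `0` at the origin AND at a point of the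
unit sphere — a Type-I cascade that has SPLIT.  The deciding obligation `stub_noCascadeSplitting`
says no such object exists: a time-Type-I ancient mild solution singular at the origin is locally
bounded near every other point at the final time (by scaling and translation: at most one
final-time singular point).  Sibling witness: for the subcritical semilinear heat equation the
analogue is a theorem (Merle–Zaag 1998/2000 Liouville: Type-I ancient solutions are independent
of `y`, so no isolated pair of blow-up points), and the transfer breaks exactly at the Giga–Kohn
weighted-energy monotonicity, whose Navier–Stokes defect is the non-gradient term
`⟨ℙ∇·(U⊗U), ∂_sU⟩_φ` — the measured deficit of this near-miss.
-/

namespace Summit.NavierStokesRegularity.NavierStokesRegularity.Cruxes.ScarEnvelopeTypeI.ScarZoom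

open MeasureTheory

local notation "E3" => EuclideanSpace ℝ (Fin 3)

/-! ### Objects of the line — LANDED as `Theorems/TypeIQuarterGateScarZoomDefs.lean` (p606736)

`CruxHypotheses`, `Envelope`, `TameOutside`, `ScarViolators`, `SingularAt`, `TwinScarObject` are now tree
declarations of this namespace (verbatim copies of the v4 skeleton's definitions, `E3` spelled out),
imported above; the registered stub signatures below are unchanged. -/

/-! ### STUB 0 `stub_blowupIsCompact` — LANDED (ns-sz-p1 g2, `Theorems/…BlowupIsCompact.lean`)

`theorem stub_blowupIsCompact : ∀ (ν T : ℝ) (u : ℝ → E3 → E3) (p : ℝ → E3 → ℝ),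
  CruxHypotheses ν T u p → TameOutside T u` is the tree theorem
`Theorems/TypeIQuarterGateScarEnvelopeTypeIBlowupIsCompact.lean` (same namespace, registered signature verbatim,
0 sorry, UNCONDITIONAL).  Proof by the tree's PROVED Kato `C_t L³` theory: the classical Leray–Hopf solution
from a rapidly decaying datum is a Kato solution (`isKatoSolutionOn_of_classical`); far field up to `T` by
`IsKatoSolutionOn.farField_bound_holds` (Lemarié-Rieusset Thm 15.1 (C) / Rusin–Šverák §4), interior slab by
`exists_ae_norm_le_of_pos`, initial layer by `kato_local_bounded_holds` + `kato_unique_holds` (the datum is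
bounded); essential bounds are pointwise by joint continuity.  Used below BY NAME. -/

/-! ### STUB A `stub_violatorsApproachScar` — LANDED (p607379, ns-sz-p1 g2)

`theorem stub_violatorsApproachScar : ∀ (ν T : ℝ) (u : ℝ → E3 → E3) (p : ℝ → E3 → ℝ),
  CruxHypotheses ν T u p → TameOutside T u → ¬ Envelope T u → ScarViolators T u` is the tree theorem
`Theorems/TypeIQuarterGateScarEnvelopeTypeIViolatorsApproachScar.lean` (same namespace, registered
signature verbatim, 0 sorry; proof = the critic's P2 reading: violators at `(σ, C' = k)`, tameness +
joint continuity ⇒ `t_k → T`, far field ⇒ subsequence `x_k → b`, finite-scar clause ⇒ `b ∈ σ`, eventual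
Type-I rate ⇒ `x_k ≠ b`, `(T−t_k)/‖x_k−b‖² ≤ 4C²/k`, `‖x_k−b‖‖u‖ ≥ k/2`), used below BY NAME. -/

/-! ### STUB B `stub_scarZoom` — LANDED (ns-sz-p1 g2; files …TranslatedPersistence p608814,
…TwinCompactness p608980, …TwinZoomLimit p609629, …ScarZoom = the stub)

`theorem stub_scarZoom : ∀ (ν T : ℝ) (u : ℝ → E3 → E3) (p : ℝ → E3 → ℝ),
  CruxHypotheses ν T u p → ScarViolators T u → ∃ (M : ℝ) (v : ℝ → E3 → E3), TwinScarObject M v` is the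
tree theorem `Theorems/TypeIQuarterGateScarEnvelopeTypeIScarZoom.lean` (same namespace, registered signature
verbatim, 0 sorry, UNCONDITIONAL).  Proof: Morrey bound of the Type-I solution + the viscosity-normalising
zoom about the scar `(T,a)` in Albritton–Barker's local class with `𝐈 < ∞` (tree `morrey_of_typeI`,
`exists_zoom_typeIBound_lt_top_of_morrey`); the violators make `(T,a)` a genuine singular point; the zoom-in
at the PRESCRIBED scales `‖x_k − a‖/R` with the satellites `(x_k − a)/‖x_k − a‖ → e ∈ S²` and zoomed times
`(t_k − T)R²/(β‖x_k − a‖²) → 0⁻` (tree Barker–Prange/Albritton–Barker engine `LocalTypeIBlowup.*`, KNSS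
Lemma 3.1 / Prop 4.1 representative, persistence of singularities = A–B Prop 2.3 at the origin AND, by the
unit-scale translation, at `(0,e)`) gives `U ∈ IsTypeIAncientMild C₁` singular at `0` and `e`; the local
energy clause is `A(Q((0,x₀),1)) ≤ 𝐈` upgraded from essential to every time by joint continuity (Fatou).
Used below BY NAME. -/

/-- STUB C (DECIDING; size XL).  NO CASCADE SPLITTING: there is no twin-scar object — a
time-Type-I ancient mild solution singular at the origin at its final time is locally bounded
near every other point there (equivalently, by scaling and translation, it has at most one
final-time singular point).  Strictly stronger than the crux (profile level); implied by "no
singular time-Type-I ancient mild solution" and hence by (L) = stmt-0057.  Why it might fail: a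
Type-I ancient solution whose cascade bifurcates (two simultaneous collapse centres at unit
distance) refutes it; the subcritical semilinear-heat analogue is TRUE (Merle–Zaag Liouville),
the Navier–Stokes transfer breaks at the Giga–Kohn monotonicity.  Instrument: two-centre
backward profile searches (angular-Galerkin / pub-ns-dss truncations): a converged two-lobe
Type-I ancient profile is a plausibility strike. -/
theorem stub_noCascadeSplitting :
    ∀ (M : ℝ) (v : ℝ → E3 → E3), ¬ TwinScarObject M v := by
  sorry

/-- RUNG (proved, small-constant regime): the deciding stub holds for every Type-I constant
`M < 1`, by the tree's time-only small-constant Liouville theorem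
`SimilarityEnstrophy.typeI_ancient_eq_zero_of_rate_lt_one` (T31⁗: `IsTypeIAncientMild M v`,
`M < 1` ⇒ `v ≡ 0` on `t < 0`), which is incompatible with `SingularAt v 0`.  This certifies that
the class is typed in the tree's gauge and that the stub extends a landed theorem from `M < 1` to
all `M`; the open content is `M ≥ 1`. -/
theorem noCascadeSplitting_of_lt_one (M : ℝ) (v : ℝ → E3 → E3) (hM : M < 1) :
    ¬ TwinScarObject M v := by
  rintro ⟨hv, -, hsing, -⟩
  have h0 := Summit.NavierStokesRegularity.NavierStokesRegularity.Theorems.SimilarityEnstrophy.typeI_ancient_eq_zero_of_rate_lt_one hv hM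
  obtain ⟨t, ht, y, -, hy⟩ := hsing 1 one_pos 0
  have hzero : v t y = 0 := h0 t ht.2 y
  simp [hzero] at hy

/-- COMPOSITION (kernel-checked, no `sorry`): the four stubs prove the crux BY NAME. -/
theorem ScarEnvelopeTypeI_of :
    (∀ (ν T : ℝ) (u : ℝ → E3 → E3) (p : ℝ → E3 → ℝ),
        CruxHypotheses ν T u p → TameOutside T u) →
    (∀ (ν T : ℝ) (u : ℝ → E3 → E3) (p : ℝ → E3 → ℝ),
        CruxHypotheses ν T u p → TameOutside T u → ¬ Envelope T u → ScarViolators T u) →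
    (∀ (ν T : ℝ) (u : ℝ → E3 → E3) (p : ℝ → E3 → ℝ),
        CruxHypotheses ν T u p → ScarViolators T u →
          ∃ (M : ℝ) (v : ℝ → E3 → E3), TwinScarObject M v) →
    (∀ (M : ℝ) (v : ℝ → E3 → E3), ¬ TwinScarObject M v) →
      Summit.NavierStokesRegularity.NavierStokesRegularity.Theses.TypeIQuarterGate.ScarEnvelopeTypeI := by
  intro h0 hA hB hC ν T hν hT u p hmax hLH hdec hTI hfin
  by_contra hEnv
  have H : CruxHypotheses ν T u p := ⟨hν, hT, hmax, hLH, hdec, hTI, hfin⟩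
  obtain ⟨M, v, hv⟩ := hB ν T u p H (hA ν T u p H (h0 ν T u p H) hEnv)
  exact hC M v hv

/-- The composition instantiated with the registered stubs. -/
theorem ScarEnvelopeTypeI_of_stubs :
    Summit.NavierStokesRegularity.NavierStokesRegularity.Theses.TypeIQuarterGate.ScarEnvelopeTypeI :=
  ScarEnvelopeTypeI_of stub_blowupIsCompact stub_violatorsApproachScar stub_scarZoom
    stub_noCascadeSplitting

end Summit.NavierStokesRegularity.NavierStokesRegularity.Cruxes.ScarEnvelopeTypeI.ScarZoom
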